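import Mathlib
import Literature.Probability.RandomGraphs.LowDegree

/-!
# The block–Walsh identity (the exact lever of card `voronoi-blocks-on-fixed-gs`)

Crux `Summit.CriticalPhenomena.CardyFormulaZ2.Theses.CardyFlipRusso.SquareFromVoronoiHub`
(stmt-CriticalPhenomena-6434), line `Sketch`, stub family C⁺ (`stub_blockInvariance`, held by the
lead).  The card's mechanism for C⁺ is a Russo-type interpolation in the cell scale `s` of the block
colourings of the fixed lattice `G_s`; its first, exact, lemma is the **block–Walsh identity**:
the expectation of any observable `g` of a fair BLOCK-constant colouring (one fair coin per block,
all sites of a block share it) equals the total Walsh–Fourier mass of `g` (w.r.t. the fair i.i.d.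
colouring) on the index sets meeting every block in an EVEN number of sites,

  `E_block[g] = Σ_{A : every block meets A evenly} ĝ(A)`,   `ĝ(A) = E_iid[g · χ_A]`,

i.e. the Radon–Nikodym density of the block law w.r.t. the i.i.d. law is the even Walsh polynomial
`Π_blocks Σ_{A ⊆ block, |A| even} χ_A` (O'Donnell, *Analysis of Boolean Functions* (2014), §1.4
Fourier inversion, applied to the uniform law on the subgroup of block-constant colourings, whose
annihilator is the family of evenly-met index sets).  Here for an arbitrary finite index type `ι`,
block type `β` and block map `blk : ι → β` (blocks may be empty), over the tree's Walsh characters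
`Literature.Probability.RandomGraphs.LowDegree.walsh A x = ∏_{i ∈ A} (-1)^{x i}`:

* `sum_walsh_comp_eq` — `Σ_{c : β → Bool} χ_A(c ∘ blk) = 2^{|β|} · [A meets every block evenly]`;
* `walsh_inversion` — Fourier inversion on `{0,1}^ι` for a general finite `ι`;
* `stub_blockWalsh` — the identity (registered sub-goal `stub_blockWalsh` of the crux item).

No definitions (the parity predicate "`A` meets every block evenly" is spelled out inline).
-/

noncomputable section

namespace Summit.CriticalPhenomena.CardyFormulaZ2.Cruxes.SquareFromVoronoiHub.VoronoiBlocks.Walsh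

open Finset
open Literature.Probability.RandomGraphs.LowDegree (sgn walsh sgn_true sgn_false sum_walsh_mul_walsh)

variable {ι β : Type*} [Fintype ι] [DecidableEq ι] [Fintype β] [DecidableEq β]

/-- `Σ_{v : Bool} (-1)^{v·n} = 2·[n even]`. [folklore] -/
theorem sum_sgn_pow (n : ℕ) : ∑ v : Bool, sgn v ^ n = if Even n then 2 else 0 := by
  rw [Fintype.sum_bool, sgn_true, sgn_false, one_pow]
  rcases Nat.even_or_odd n with h | h
  · rw [if_pos h, h.neg_one_pow]; norm_num
  · rw [if_neg (Nat.not_even_iff_odd.2 h), h.neg_one_pow]; norm_num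

omit [Fintype ι] [DecidableEq ι] in
/-- A Walsh character read on a block-constant colouring factors over the blocks:
`χ_A(c ∘ blk) = ∏_b (-1)^{c b · #(A ∩ blk⁻¹ b)}`. [folklore] -/
theorem walsh_comp_eq_prod (blk : ι → β) (A : Finset ι) (c : β → Bool) :
    walsh A (c ∘ blk) = ∏ b, sgn (c b) ^ (A.filter fun i => blk i = b).card := by
  unfold walsh
  rw [← Finset.prod_fiberwise_of_maps_to (g := blk) (t := (Finset.univ : Finset β))
    (fun i _ => Finset.mem_univ _)]
  refine Finset.prod_congr rfl fun b _ => ?_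
  rw [Finset.prod_congr rfl (g := fun _ => sgn (c b)) (fun i hi => ?_), Finset.prod_const]
  obtain ⟨-, hib⟩ := Finset.mem_filter.1 hi
  simp [Function.comp, hib]

omit [Fintype ι] [DecidableEq ι] in
/-- **Characters averaged over block-constant colourings**:
`Σ_{c : β → Bool} χ_A(c ∘ blk) = 2^{|β|}` if `A` meets every block evenly, and `0` otherwise
(the annihilator of the subgroup of block-constant colourings). [folklore] -/
theorem sum_walsh_comp_eq (blk : ι → β) (A : Finset ι) :
    ∑ c : β → Bool, walsh A (c ∘ blk) =
      if (∀ b : β, Even ((A.filter fun i => blk i = b).card)) then (2 : ℝ) ^ Fintype.card β else 0 := by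
  simp_rw [walsh_comp_eq_prod]
  rw [← Fintype.prod_sum (fun b (v : Bool) => sgn v ^ (A.filter fun i => blk i = b).card)]
  simp_rw [sum_sgn_pow]
  by_cases h : ∀ b : β, Even ((A.filter fun i => blk i = b).card)
  · rw [if_pos h, Finset.prod_congr rfl (g := fun _ => (2 : ℝ)) fun b _ => if_pos (h b),
      Finset.prod_const, Finset.card_univ]
  · rw [if_neg h]
    obtain ⟨b, hb⟩ : ∃ b, ¬ Even ((A.filter fun i => blk i = b).card) := by
      by_contra hcon; push Not at hcon; exact h hcon
    exact Finset.prod_eq_zero (Finset.mem_univ b) (if_neg hb)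

/-- **Fourier inversion on `{0,1}^ι`** for an arbitrary finite index type:
`Σ_A (2^{-|ι|} Σ_x g x χ_A(x)) χ_A(y) = g y` (O'Donnell 2014, Thm 1.1). [cite: ODonnell2014, Thm 1.1] -/
theorem walsh_inversion (g : (ι → Bool) → ℝ) (y : ι → Bool) :
    ∑ A : Finset ι, ((Fintype.card (ι → Bool) : ℝ)⁻¹ * ∑ x, g x * walsh A x) * walsh A y = g y := by
  have hN : (Fintype.card (ι → Bool) : ℝ) = 2 ^ Fintype.card ι := by
    rw [Fintype.card_fun, Fintype.card_bool]; push_cast; ring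
  have h2 : (2 : ℝ) ^ Fintype.card ι ≠ 0 := by positivity
  calc ∑ A : Finset ι, ((Fintype.card (ι → Bool) : ℝ)⁻¹ * ∑ x, g x * walsh A x) * walsh A y
      = ∑ A : Finset ι, ∑ x, (Fintype.card (ι → Bool) : ℝ)⁻¹ * (g x * (walsh A x * walsh A y)) := by
        refine Finset.sum_congr rfl fun A _ => ?_
        rw [Finset.mul_sum, Finset.sum_mul]
        refine Finset.sum_congr rfl fun x _ => ?_
        ring
    _ = ∑ x, ∑ A : Finset ι, (Fintype.card (ι → Bool) : ℝ)⁻¹ * (g x * (walsh A x * walsh A y)) :=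
        Finset.sum_comm
    _ = ∑ x, (Fintype.card (ι → Bool) : ℝ)⁻¹ * (g x * ∑ A : Finset ι, walsh A x * walsh A y) := by
        refine Finset.sum_congr rfl fun x _ => ?_
        rw [Finset.mul_sum, Finset.mul_sum]
    _ = g y := by
        simp only [sum_walsh_mul_walsh, mul_ite, mul_zero, Finset.sum_ite_eq', Finset.mem_univ,
          if_true, hN]
        field_simp

/-- **The block–Walsh identity** (registered sub-goal `stub_blockWalsh` of crux
stmt-CriticalPhenomena-6434; the exact lever of card `voronoi-blocks-on-fixed-gs`): for every finite
index type `ι`, block type `β`, block map `blk : ι → β` and observable `g`, the expectation of `g`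
under the fair block-constant colouring equals the Walsh–Fourier mass of `g` on the index sets that
meet every block evenly: `2^{-|β|} Σ_c g(c ∘ blk) = Σ_{A even in blocks} 2^{-|ι|} Σ_x g x χ_A(x)`.
[cite: ODonnell2014, §1.4] -/
theorem stub_blockWalsh : ∀ {ι β : Type} [Fintype ι] [DecidableEq ι] [Fintype β] [DecidableEq β] (blk : ι → β) (g : (ι → Bool) → ℝ), (Fintype.card (β → Bool) : ℝ)⁻¹ * ∑ c : β → Bool, g (c ∘ blk) = ∑ A ∈ (Finset.univ : Finset (Finset ι)).filter (fun A => ∀ b : β, Even ((A.filter fun i => blk i = b).card)), (Fintype.card (ι → Bool) : ℝ)⁻¹ * ∑ x, g x * walsh A x := by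
  intro ι β _ _ _ _ blk g
  have hB : (Fintype.card (β → Bool) : ℝ) = 2 ^ Fintype.card β := by
    rw [Fintype.card_fun, Fintype.card_bool]; push_cast; ring
  have h2 : (2 : ℝ) ^ Fintype.card β ≠ 0 := by positivity
  -- the Walsh coefficients of `g`, kept atomic
  set G : Finset ι → ℝ := fun A => (Fintype.card (ι → Bool) : ℝ)⁻¹ * ∑ x, g x * walsh A x with hG
  -- expand `g (c ∘ blk)` by Fourier inversion and exchange the sums
  calc (Fintype.card (β → Bool) : ℝ)⁻¹ * ∑ c : β → Bool, g (c ∘ blk)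
      = (Fintype.card (β → Bool) : ℝ)⁻¹ * ∑ c : β → Bool, ∑ A : Finset ι, G A * walsh A (c ∘ blk) := by
        simp_rw [hG, walsh_inversion]
    _ = ∑ c : β → Bool, ∑ A : Finset ι, (Fintype.card (β → Bool) : ℝ)⁻¹ * (G A * walsh A (c ∘ blk)) := by
        rw [Finset.mul_sum]
        refine Finset.sum_congr rfl fun c _ => ?_
        rw [Finset.mul_sum]
    _ = ∑ A : Finset ι, ∑ c : β → Bool, (Fintype.card (β → Bool) : ℝ)⁻¹ * (G A * walsh A (c ∘ blk)) :=
        Finset.sum_comm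
    _ = ∑ A : Finset ι, G A * ((Fintype.card (β → Bool) : ℝ)⁻¹ * ∑ c : β → Bool, walsh A (c ∘ blk)) := by
        refine Finset.sum_congr rfl fun A _ => ?_
        rw [Finset.mul_sum, Finset.mul_sum]
        refine Finset.sum_congr rfl fun c _ => ?_
        ring
    _ = ∑ A ∈ (Finset.univ : Finset (Finset ι)).filter (fun A => ∀ b : β, Even ((A.filter fun i => blk i = b).card)),
          G A := by
        rw [Finset.sum_filter]
        refine Finset.sum_congr rfl fun A _ => ?_
        rw [sum_walsh_comp_eq, hB]
        by_cases h : ∀ b : β, Even ((A.filter fun i => blk i = b).card)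
        · rw [if_pos h, if_pos h, inv_mul_cancel₀ h2, mul_one]
        · rw [if_neg h, if_neg h, mul_zero, mul_zero]

end Summit.CriticalPhenomena.CardyFormulaZ2.Cruxes.SquareFromVoronoiHub.VoronoiBlocks.Walsh

end
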